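import Summits.QuantumFields.YangMills.Theorems.LangevinControlUVOSLegsAtWeakCouplingCStubInheritAxis
import HarnessLib

/-!
# Stub `stub_inherit` of line `inherited-amplitude-gates` (crux `OSLegsAtWeakCouplingC`, stmt-QuantumFields-16207):
# auxiliary file 3 — propagation to the density pair: FlatShape2 and GateD

The PROPAGATE step of the inheritance lemma, at one density pair `(x, y)` of a femto cube `(c, b)` and one exterior
`η`.  With `ν = ‖y − x‖`, an integer `m ∈ [ν, 2ν]` and the axis pair `(x, x + m e₂)`:

* (U) `pair_upper`: the flat axis value `K_ax(1)` is bounded by the solve step (`flatAxis_bounds` (U), auxiliary file 2),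
  `FlatShape2` compares it two-sidedly with the flat density value `K_D(1)` (`abs_le_of_two_sided`), and `GateD` with the
  FBL6 budget `M' = 2C₁/((κ−2)ν)⁴` transfers the bound to every exterior (`gate_transfer_abs_le`):
  `|ν⁸ K_D(η)| ≤ (3/2)(θ + θ⁻¹)(2C + 8(1 + C_g + C_g²)C₁²/(κ−2)⁸) + 4(C_g' + C_g'²)C₁²/(κ−2)⁸`;
* (L) `pair_lower`: if the shape function satisfies `Γ(m a) ≥ K_f (m a)⁸`, the pair's physical separation is `≥ s₁` and
  the gate parameter `κ` is large enough (`K_f s₁⁸ (κ−2)⁸` beats the two explicit constants), then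
  `ν⁸ K_D(η) ≥ θ c K_f s₁⁸ / 8` (`flatAxis_bounds` (L), `FlatShape2`, `gate_transfer_lower`).

Refs: line card `Cruxes/OSLegsAtWeakCouplingC/Lines/inherited-amplitude-gates.md` (stub_inherit (iv)–(v)).
-/

set_option autoImplicit false

noncomputable section

open scoped BigOperators
open MeasureTheory Filter Topology
open Literature.MathematicalPhysics.QuantumFieldTheory Literature.MathematicalPhysics.QuantumLattice
open Literature.MathematicalPhysics.AQFT Literature.Probability.LatticeModels
open Summit.QuantumFields.YangMills.Cruxes.OSLegsFromFemtoAndGap.DlrCollarTransfer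
open Summit.QuantumFields.YangMills.Cruxes.OSLegsFromFemtoAndGap.DlrCollarTransfer.StubLower
open Summit.QuantumFields.YangMills.Theorems.OSLegsFromFemtoAndGap.StubLower

namespace Summit.QuantumFields.YangMills.Cruxes.OSLegsAtWeakCouplingC.InheritedAmplitudeGates.StubInherit

/-! ### Real arithmetic -/

/-- A two-sided multiplicative comparison `θ A ≤ D`, `θ D ≤ A` (`θ > 0`) bounds `|D|` by `(θ + θ⁻¹)|A|`. [folklore] -/
theorem abs_le_of_two_sided {θ A D : ℝ} (hθ : 0 < θ) (h1 : θ * A ≤ D) (h2 : θ * D ≤ A) :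
    |D| ≤ (θ + θ⁻¹) * |A| := by
  have hθ' : 0 < θ⁻¹ := inv_pos.2 hθ
  have hA : A ≤ |A| := le_abs_self A
  have hA' : -A ≤ |A| := neg_le_abs A
  rcases le_or_gt 0 D with hD | hD
  · rw [abs_of_nonneg hD]
    have h3 : D ≤ θ⁻¹ * A := by
      rw [le_inv_mul_iff₀' hθ]; linarith
    nlinarith
  · rw [abs_of_neg hD]
    nlinarith

/-- `ν⁸ · (2C₁/((κ−2)ν)⁴)² = 4 C₁² / (κ−2)⁸` for `ν ≠ 0`. [folklore] -/
theorem pow_mul_budget_sq {C₁ k ν : ℝ} (hν : ν ≠ 0) (hk : k ≠ 0) :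
    ν ^ 8 * (2 * C₁ / (k * ν) ^ 4) ^ 2 = 4 * C₁ ^ 2 / k ^ 8 := by
  field_simp
  ring

/-! ### The propagation step at one density pair -/

section Pair

variable (G : Type) [Group G] [TopologicalSpace G] [IsTopologicalGroup G] [CompactSpace G]
  [MeasurableSpace G] [BorelSpace G] (r : LatticeRep G) (a : ℝ → ℝ)

/-- **(U) at one pair.**  Data: H1 (`c, C, Γ`, box clause), FBL6 (`C₁`, clause), `GateAxis` (`C_g`, `n₆`, clause),
`GateD` (`C_g'`, `n₆'`, clause), `FlatShape2` (`θ`, `κ₇`, `n₇`, clause).  Instance: `β` past all thresholds, a femto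
cube, a gate parameter `κ ≥ 8` with `4C_g, 4C_g' ≤ κ²`, a density pair `(x, y)` at separation `ν ≥ 1`, an integer
`m ∈ [ν, 2ν]` with `n₆ ≤ m`, `8m ≤ b + 3`, and the depth conditions of the three clauses at `x`, `y`, `x + m e₂`.
Then `|ν⁸ K_D(η)| ≤ (3/2)(θ + θ⁻¹)(2C + 8(1 + C_g + C_g²)C₁²/(κ−2)⁸) + 4(C_g' + C_g'²)C₁²/(κ−2)⁸` for EVERY
exterior `η`. [folklore] -/
theorem pair_upper
    {Γ : ℝ → ℝ} {β₀ ℓ₀ c C : ℝ} (hc : 0 < c) (hΓ : ∀ s : ℝ, 0 < s → s ≤ ℓ₀ → 0 < Γ s ∧ Γ s ≤ 1)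
    (hbox : ∀ (L : ℕ) [NeZero L] (β : ℝ), β₀ ≤ β → (L : ℝ) * a β ≤ ℓ₀ → let P : (Fin 4 → ZMod L) → Fin 4 → Fin 4 → GaugeConfig 4 L G → ℝ := fun x i j U => (r.N : ℝ) - (r.ρ (plaquetteHolonomy U x i j)).trace.re; let E : (GaugeConfig 4 L G → ℝ) → ℝ := fun F => wilsonExpectation (d := 4) (L := L) r.ρ β F; let cov : (GaugeConfig 4 L G → ℝ) → (GaugeConfig 4 L G → ℝ) → ℝ := fun F F' => E (fun U => F U * F' U) - E F * E F'; let dist : (Fin 4 → ZMod L) → (Fin 4 → ZMod L) → ℝ := fun x y => Real.sqrt (∑ k : Fin 4, (((x k - y k).valMinAbs : ℤ) : ℝ) ^ 2); (∀ n : ℕ, 1 ≤ n → 8 * n ≤ L → c * Γ ((n : ℝ) * a β) ≤ (n : ℝ) ^ 8 * cov (P 0 0 1) (P (Pi.single (2 : Fin 4) ((n : ℕ) : ZMod L)) 0 1) ∧ (n : ℝ) ^ 8 * cov (P 0 0 1) (P (Pi.single (2 : Fin 4) ((n : ℕ) : ZMod L)) 0 1) ≤ C * Γ ((n : ℝ)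 * a β)) ∧ (∀ (x y : Fin 4 → ZMod L) (i j i' j' : Fin 4), x ≠ y → i ≠ j → i' ≠ j' → |cov (P x i j) (P y i' j')| * dist x y ^ 8 ≤ C * Γ (dist x y * a β)))
    {C₁ β₁ ℓ₁ : ℝ} {p : Fin 4 × Fin 4 → ℝ → ℝ} (hC₁ : 0 ≤ C₁)
    (hFBL : ∀ β : ℝ, β₁ ≤ β → ∀ (c : Fin 4 → ℤ) (b : ℕ), (b : ℝ) * a β ≤ ℓ₁ →
      ∀ (η : LGConfig 4 G) (q : Fin 4 × Fin 4) (x : Fin 4 → ℤ), q.1 < q.2 → 2 ≤ depth c b x →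
        |kerE G r β c b η (plane G r q x) - p q β| ≤ C₁ / (depth c b x : ℝ) ^ 4)
    {Cg β₆ ℓ₆ : ℝ} {n₆ : ℕ}
    (hGA : ∀ β : ℝ, β₆ ≤ β → ∀ κ : ℕ, 8 ≤ κ →
      ∀ (c : Fin 4 → ℤ) (b : ℕ), (b : ℝ) * a β ≤ ℓ₆ → ∀ (η : LGConfig 4 G) (x : Fin 4 → ℤ) (n : ℕ), n₆ ≤ n →
        κ * n ≤ depth c b x → κ * n ≤ depth c b (x + Pi.single (2 : Fin 4) (n : ℤ)) →
        ∀ M : ℝ, 0 ≤ M →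
          (∀ (q : Fin 4 × Fin 4) (z : Fin 4 → ℤ), q.1 < q.2 → (κ - 2) * n ≤ depth c b z →
            |kerE G r β c b η (plane G r q z) - kerE G r β c b 1 (plane G r q z)| ≤ M) →
          |kerCov G r β c b η (plane G r (0, 1) x) (plane G r (0, 1) (x + Pi.single (2 : Fin 4) (n : ℤ))) -
              kerCov G r β c b 1 (plane G r (0, 1) x) (plane G r (0, 1) (x + Pi.single (2 : Fin 4) (n : ℤ)))| ≤
            Cg * (M * Real.sqrt (kerCov G r β c b 1 (plane G r (0, 1) x) (plane G r (0, 1) (x + Pi.single (2 : Fin 4) (n : ℤ)))) +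
              M ^ 2 + |kerCov G r β c b 1 (plane G r (0, 1) x) (plane G r (0, 1) (x + Pi.single (2 : Fin 4) (n : ℤ)))| / (κ : ℝ) ^ 2))
    {Cg' β₆' ℓ₆' : ℝ} {n₆' : ℕ} (hCg' : 0 < Cg')
    (hGD : ∀ β : ℝ, β₆' ≤ β → ∀ κ : ℕ, 8 ≤ κ →
      ∀ (c : Fin 4 → ℤ) (b : ℕ), (b : ℝ) * a β ≤ ℓ₆' → ∀ (η : LGConfig 4 G) (x y : Fin 4 → ℤ),
        (n₆' : ℝ) ≤ ‖siteToE (y - x)‖ →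
        (κ : ℝ) * ‖siteToE (y - x)‖ ≤ depth c b x → (κ : ℝ) * ‖siteToE (y - x)‖ ≤ depth c b y →
        ∀ M : ℝ, 0 ≤ M →
          (∀ (q : Fin 4 × Fin 4) (z : Fin 4 → ℤ), q.1 < q.2 → ((κ : ℝ) - 2) * ‖siteToE (y - x)‖ ≤ depth c b z →
            |kerE G r β c b η (plane G r q z) - kerE G r β c b 1 (plane G r q z)| ≤ M) →
          |kerCov G r β c b η (dens G r x) (dens G r y) - kerCov G r β c b 1 (dens G r x) (dens G r y)| ≤
            Cg' * (M * Real.sqrt (kerCov G r β c b 1 (dens G r x) (dens G r y)) + M ^ 2 +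
              |kerCov G r β c b 1 (dens G r x) (dens G r y)| / (κ : ℝ) ^ 2))
    {θ β₇ ℓ₇ : ℝ} {κ₇ n₇ : ℕ} (hθ : 0 < θ)
    (hFS : ∀ β : ℝ, β₇ ≤ β →
      ∀ (c : Fin 4 → ℤ) (b : ℕ), (b : ℝ) * a β ≤ ℓ₇ → ∀ (x y x' : Fin 4 → ℤ) (m : ℕ),
        (n₇ : ℝ) ≤ ‖siteToE (y - x)‖ → ‖siteToE (y - x)‖ ≤ m → (m : ℝ) ≤ 2 * ‖siteToE (y - x)‖ →
        (κ₇ : ℝ) * m ≤ depth c b x → (κ₇ : ℝ) * m ≤ depth c b y →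
        (κ₇ : ℝ) * m ≤ depth c b x' → (κ₇ : ℝ) * m ≤ depth c b (x' + Pi.single (2 : Fin 4) (m : ℤ)) →
          θ * kerCov G r β c b 1 (plane G r (0, 1) x') (plane G r (0, 1) (x' + Pi.single (2 : Fin 4) (m : ℤ))) ≤
            kerCov G r β c b 1 (dens G r x) (dens G r y) ∧
          θ * kerCov G r β c b 1 (dens G r x) (dens G r y) ≤
            kerCov G r β c b 1 (plane G r (0, 1) x') (plane G r (0, 1) (x' + Pi.single (2 : Fin 4) (m : ℤ))))
    -- the instance
    {β : ℝ} (hβ₀ : β₀ ≤ β) (hβ₁ : β₁ ≤ β) (hβ₆ : β₆ ≤ β) (hβ₆' : β₆' ≤ β) (hβ₇ : β₇ ≤ β) (hα : 0 < a β)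
    {cc : Fin 4 → ℤ} {b : ℕ} (hb₁ : (b : ℝ) * a β ≤ ℓ₁) (hb₆ : (b : ℝ) * a β ≤ ℓ₆) (hb₆' : (b : ℝ) * a β ≤ ℓ₆')
    (hb₇ : (b : ℝ) * a β ≤ ℓ₇) (hb₀ : ((b : ℝ) + 3) * a β ≤ ℓ₀)
    {κ : ℕ} (hκ8 : 8 ≤ κ) (hκCg : 4 * Cg ≤ (κ : ℝ) ^ 2) (hκCg' : 4 * Cg' ≤ (κ : ℝ) ^ 2)
    (η : LGConfig 4 G) {x y : Fin 4 → ℤ} {m : ℕ} (hν1 : 1 ≤ ‖siteToE (y - x)‖)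
    (hn₆' : (n₆' : ℝ) ≤ ‖siteToE (y - x)‖) (hn₇ : (n₇ : ℝ) ≤ ‖siteToE (y - x)‖)
    (hm1 : 1 ≤ m) (hn₆m : n₆ ≤ m) (hνm : ‖siteToE (y - x)‖ ≤ m) (hm2 : (m : ℝ) ≤ 2 * ‖siteToE (y - x)‖)
    (h8m : 8 * m ≤ b + 3)
    (hdx : κ * m ≤ depth cc b x) (hdx' : κ * m ≤ depth cc b (x + Pi.single (2 : Fin 4) (m : ℤ)))
    (hdxr : (κ : ℝ) * ‖siteToE (y - x)‖ ≤ depth cc b x) (hdyr : (κ : ℝ) * ‖siteToE (y - x)‖ ≤ depth cc b y)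
    (h7x : (κ₇ : ℝ) * m ≤ depth cc b x) (h7y : (κ₇ : ℝ) * m ≤ depth cc b y)
    (h7x' : (κ₇ : ℝ) * m ≤ depth cc b (x + Pi.single (2 : Fin 4) (m : ℤ))) :
    |‖siteToE (y - x)‖ ^ 8 * kerCov G r β cc b η (dens G r x) (dens G r y)| ≤
      3 / 2 * (θ + θ⁻¹) * (2 * C + 8 * (1 + Cg + Cg ^ 2) * C₁ ^ 2 / ((κ : ℝ) - 2) ^ 8) +
        4 * (Cg' + Cg' ^ 2) * C₁ ^ 2 / ((κ : ℝ) - 2) ^ 8 := by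
  have hm0 : (0 : ℝ) < m := by exact_mod_cast hm1
  have hκr : (8 : ℝ) ≤ κ := by exact_mod_cast hκ8
  have hκ2 : (6 : ℝ) ≤ (κ : ℝ) - 2 := by linarith only [hκr]
  have hκ0 : (0 : ℝ) < κ := by linarith only [hκr]
  have hν0 : (0 : ℝ) < ‖siteToE (y - x)‖ := by linarith only [hν1]
  -- (1) the flat axis value
  obtain ⟨hU, -⟩ := flatAxis_bounds G r a hc hΓ hbox hC₁ hFBL hGA hβ₀ hβ₁ hβ₆ hα hb₁ hb₆ hb₀ hκ8 hκCg hm1 hn₆m h8m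
    hdx hdx'
  -- (2) FlatShape2: the flat density value
  obtain ⟨hθ1, hθ2⟩ := hFS β hβ₇ cc b hb₇ x y x m hn₇ hνm hm2 h7x h7y h7x h7x'
  have hD1 := abs_le_of_two_sided hθ hθ1 hθ2
  -- (3) the budget of GateD from FBL6, and GateD
  obtain ⟨M', hM'⟩ : ∃ M' : ℝ, M' = 2 * C₁ / (((κ : ℝ) - 2) * ‖siteToE (y - x)‖) ^ 4 := ⟨_, rfl⟩
  have hM'0 : 0 ≤ M' := by rw [hM']; positivity
  have h2d : (2 : ℝ) ≤ ((κ : ℝ) - 2) * ‖siteToE (y - x)‖ := by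
    have := mul_le_mul hκ2 hν1 (by norm_num) (by linarith only [hκ2])
    linarith only [this]
  have hbud : ∀ (q : Fin 4 × Fin 4) (z : Fin 4 → ℤ), q.1 < q.2 →
      ((κ : ℝ) - 2) * ‖siteToE (y - x)‖ ≤ depth cc b z →
      |kerE G r β cc b η (plane G r q z) - kerE G r β cc b 1 (plane G r q z)| ≤ M' := by
    intro q z hq hz
    rw [hM']
    exact budget_of_fbl6 G r a hC₁ (hFBL β hβ₁) hb₁ h2d η q z hq hz
  have hgateD := hGD β hβ₆' κ hκ8 cc b hb₆' η x y hn₆' hdxr hdyr M' hM'0 hbud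
  have hDη := gate_transfer_abs_le hCg'.le hκCg' hκ0 hgateD
  -- (4) assemble: `ν⁸ |K_D(η)| ≤ (3/2)(θ+θ⁻¹) ν⁸ |K_ax| + (Cg'+Cg'²) ν⁸ M'²`
  have hνm8 : ‖siteToE (y - x)‖ ^ 8 ≤ (m : ℝ) ^ 8 := pow_le_pow_left₀ hν0.le hνm 8
  have hk0 : ((κ : ℝ) - 2) ≠ 0 := (by linarith only [hκ2] : (0 : ℝ) < (κ : ℝ) - 2).ne'
  have hB : (m : ℝ) ^ 8 * (4 * (1 + Cg + Cg ^ 2) * C₁ ^ 2 / (((κ : ℝ) - 2) * m) ^ 8) =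
      4 * (1 + Cg + Cg ^ 2) * C₁ ^ 2 / ((κ : ℝ) - 2) ^ 8 := by
    field_simp
  have hM'8 : ‖siteToE (y - x)‖ ^ 8 * M' ^ 2 = 4 * C₁ ^ 2 / ((κ : ℝ) - 2) ^ 8 := by
    rw [hM']
    exact pow_mul_budget_sq hν0.ne' hk0
  rw [abs_mul, abs_of_nonneg (by positivity : (0 : ℝ) ≤ ‖siteToE (y - x)‖ ^ 8)]
  -- `ν⁸ |K_ax| ≤ m⁸ |K_ax| ≤ 2C + 8(…)`
  have hax : ‖siteToE (y - x)‖ ^ 8 * |kerCov G r β cc b 1 (plane G r (0, 1) x)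
      (plane G r (0, 1) (x + Pi.single (2 : Fin 4) (m : ℤ)))| ≤
      2 * C + 8 * (1 + Cg + Cg ^ 2) * C₁ ^ 2 / ((κ : ℝ) - 2) ^ 8 := by
    have h1 := mul_le_mul_of_nonneg_right hνm8 (abs_nonneg (kerCov G r β cc b 1 (plane G r (0, 1) x)
      (plane G r (0, 1) (x + Pi.single (2 : Fin 4) (m : ℤ)))))
    have h2 : 2 * C + 2 * (m : ℝ) ^ 8 * (4 * (1 + Cg + Cg ^ 2) * C₁ ^ 2 / (((κ : ℝ) - 2) * m) ^ 8) =
        2 * C + 8 * (1 + Cg + Cg ^ 2) * C₁ ^ 2 / ((κ : ℝ) - 2) ^ 8 := by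
      rw [show 2 * (m : ℝ) ^ 8 * (4 * (1 + Cg + Cg ^ 2) * C₁ ^ 2 / (((κ : ℝ) - 2) * m) ^ 8) =
        2 * ((m : ℝ) ^ 8 * (4 * (1 + Cg + Cg ^ 2) * C₁ ^ 2 / (((κ : ℝ) - 2) * m) ^ 8)) by ring, hB]
      ring
    linarith only [h1, hU, h2]
  have hθθ : 0 ≤ θ + θ⁻¹ := by positivity
  have hν8 : 0 ≤ ‖siteToE (y - x)‖ ^ 8 := by positivity
  calc ‖siteToE (y - x)‖ ^ 8 * |kerCov G r β cc b η (dens G r x) (dens G r y)|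
      ≤ ‖siteToE (y - x)‖ ^ 8 * (3 / 2 * |kerCov G r β cc b 1 (dens G r x) (dens G r y)| + (Cg' + Cg' ^ 2) * M' ^ 2) :=
        mul_le_mul_of_nonneg_left hDη hν8
    _ ≤ ‖siteToE (y - x)‖ ^ 8 * (3 / 2 * ((θ + θ⁻¹) * |kerCov G r β cc b 1 (plane G r (0, 1) x)
          (plane G r (0, 1) (x + Pi.single (2 : Fin 4) (m : ℤ)))|) + (Cg' + Cg' ^ 2) * M' ^ 2) := by
        gcongr
    _ = 3 / 2 * (θ + θ⁻¹) * (‖siteToE (y - x)‖ ^ 8 * |kerCov G r β cc b 1 (plane G r (0, 1) x)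
          (plane G r (0, 1) (x + Pi.single (2 : Fin 4) (m : ℤ)))|) + (Cg' + Cg' ^ 2) * (‖siteToE (y - x)‖ ^ 8 * M' ^ 2) := by
        ring
    _ ≤ 3 / 2 * (θ + θ⁻¹) * (2 * C + 8 * (1 + Cg + Cg ^ 2) * C₁ ^ 2 / ((κ : ℝ) - 2) ^ 8) +
          (Cg' + Cg' ^ 2) * (4 * C₁ ^ 2 / ((κ : ℝ) - 2) ^ 8) := by
        rw [hM'8]
        have hCg2 : 0 ≤ Cg' + Cg' ^ 2 := by positivity
        nlinarith only [hax, hθθ, hCg2]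
    _ = _ := by ring

/-- **(L) at one pair.**  Same data and instance as `pair_upper`, plus: a fit constant `K_f > 0` with
`Γ(m a) ≥ K_f (m a)⁸` at the axis scale, a physical floor `s₁ ≤ ν a` (`s₁ > 0`), and a gate parameter large enough that
`c K_f s₁⁸ (κ−2)⁸ ≥ 16(1 + C_g + C_g²)C₁²` and `θ c K_f s₁⁸ (κ−2)⁸ ≥ 32(C_g' + C_g'²)C₁²`.  Then
`ν⁸ K_D(η) ≥ θ c K_f s₁⁸ / 8` for EVERY exterior `η`. [folklore] -/
theorem pair_lower
    {Γ : ℝ → ℝ} {β₀ ℓ₀ c C : ℝ} (hc : 0 < c) (hΓ : ∀ s : ℝ, 0 < s → s ≤ ℓ₀ → 0 < Γ s ∧ Γ s ≤ 1)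
    (hbox : ∀ (L : ℕ) [NeZero L] (β : ℝ), β₀ ≤ β → (L : ℝ) * a β ≤ ℓ₀ → let P : (Fin 4 → ZMod L) → Fin 4 → Fin 4 → GaugeConfig 4 L G → ℝ := fun x i j U => (r.N : ℝ) - (r.ρ (plaquetteHolonomy U x i j)).trace.re; let E : (GaugeConfig 4 L G → ℝ) → ℝ := fun F => wilsonExpectation (d := 4) (L := L) r.ρ β F; let cov : (GaugeConfig 4 L G → ℝ) → (GaugeConfig 4 L G → ℝ) → ℝ := fun F F' => E (fun U => F U * F' U) - E F * E F'; let dist : (Fin 4 → ZMod L) → (Fin 4 → ZMod L) → ℝ := fun x y => Real.sqrt (∑ k : Fin 4, (((x k - y k).valMinAbs : ℤ) : ℝ) ^ 2); (∀ n : ℕ, 1 ≤ n → 8 * n ≤ L → c * Γ ((n : ℝ) * a β) ≤ (n : ℝ) ^ 8 * cov (P 0 0 1) (P (Pi.single (2 : Fin 4) ((n : ℕ) : ZMod L)) 0 1) ∧ (n : ℝ) ^ 8 * cov (P 0 0 1) (P (Pi.single (2 : Fin 4) ((n : ℕ) : ZMod L)) 0 1) ≤ C * Γ ((n : ℝ)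 * a β)) ∧ (∀ (x y : Fin 4 → ZMod L) (i j i' j' : Fin 4), x ≠ y → i ≠ j → i' ≠ j' → |cov (P x i j) (P y i' j')| * dist x y ^ 8 ≤ C * Γ (dist x y * a β)))
    {C₁ β₁ ℓ₁ : ℝ} {p : Fin 4 × Fin 4 → ℝ → ℝ} (hC₁ : 0 ≤ C₁)
    (hFBL : ∀ β : ℝ, β₁ ≤ β → ∀ (c : Fin 4 → ℤ) (b : ℕ), (b : ℝ) * a β ≤ ℓ₁ →
      ∀ (η : LGConfig 4 G) (q : Fin 4 × Fin 4) (x : Fin 4 → ℤ), q.1 < q.2 → 2 ≤ depth c b x →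
        |kerE G r β c b η (plane G r q x) - p q β| ≤ C₁ / (depth c b x : ℝ) ^ 4)
    {Cg β₆ ℓ₆ : ℝ} {n₆ : ℕ}
    (hGA : ∀ β : ℝ, β₆ ≤ β → ∀ κ : ℕ, 8 ≤ κ →
      ∀ (c : Fin 4 → ℤ) (b : ℕ), (b : ℝ) * a β ≤ ℓ₆ → ∀ (η : LGConfig 4 G) (x : Fin 4 → ℤ) (n : ℕ), n₆ ≤ n →
        κ * n ≤ depth c b x → κ * n ≤ depth c b (x + Pi.single (2 : Fin 4) (n : ℤ)) →
        ∀ M : ℝ, 0 ≤ M →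
          (∀ (q : Fin 4 × Fin 4) (z : Fin 4 → ℤ), q.1 < q.2 → (κ - 2) * n ≤ depth c b z →
            |kerE G r β c b η (plane G r q z) - kerE G r β c b 1 (plane G r q z)| ≤ M) →
          |kerCov G r β c b η (plane G r (0, 1) x) (plane G r (0, 1) (x + Pi.single (2 : Fin 4) (n : ℤ))) -
              kerCov G r β c b 1 (plane G r (0, 1) x) (plane G r (0, 1) (x + Pi.single (2 : Fin 4) (n : ℤ)))| ≤
            Cg * (M * Real.sqrt (kerCov G r β c b 1 (plane G r (0, 1) x) (plane G r (0, 1) (x + Pi.single (2 : Fin 4) (n : ℤ)))) +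
              M ^ 2 + |kerCov G r β c b 1 (plane G r (0, 1) x) (plane G r (0, 1) (x + Pi.single (2 : Fin 4) (n : ℤ)))| / (κ : ℝ) ^ 2))
    {Cg' β₆' ℓ₆' : ℝ} {n₆' : ℕ} (hCg' : 0 < Cg')
    (hGD : ∀ β : ℝ, β₆' ≤ β → ∀ κ : ℕ, 8 ≤ κ →
      ∀ (c : Fin 4 → ℤ) (b : ℕ), (b : ℝ) * a β ≤ ℓ₆' → ∀ (η : LGConfig 4 G) (x y : Fin 4 → ℤ),
        (n₆' : ℝ) ≤ ‖siteToE (y - x)‖ →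
        (κ : ℝ) * ‖siteToE (y - x)‖ ≤ depth c b x → (κ : ℝ) * ‖siteToE (y - x)‖ ≤ depth c b y →
        ∀ M : ℝ, 0 ≤ M →
          (∀ (q : Fin 4 × Fin 4) (z : Fin 4 → ℤ), q.1 < q.2 → ((κ : ℝ) - 2) * ‖siteToE (y - x)‖ ≤ depth c b z →
            |kerE G r β c b η (plane G r q z) - kerE G r β c b 1 (plane G r q z)| ≤ M) →
          |kerCov G r β c b η (dens G r x) (dens G r y) - kerCov G r β c b 1 (dens G r x) (dens G r y)| ≤
            Cg' * (M * Real.sqrt (kerCov G r β c b 1 (dens G r x) (dens G r y)) + M ^ 2 +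
              |kerCov G r β c b 1 (dens G r x) (dens G r y)| / (κ : ℝ) ^ 2))
    {θ β₇ ℓ₇ : ℝ} {κ₇ n₇ : ℕ} (hθ : 0 < θ)
    (hFS : ∀ β : ℝ, β₇ ≤ β →
      ∀ (c : Fin 4 → ℤ) (b : ℕ), (b : ℝ) * a β ≤ ℓ₇ → ∀ (x y x' : Fin 4 → ℤ) (m : ℕ),
        (n₇ : ℝ) ≤ ‖siteToE (y - x)‖ → ‖siteToE (y - x)‖ ≤ m → (m : ℝ) ≤ 2 * ‖siteToE (y - x)‖ →
        (κ₇ : ℝ) * m ≤ depth c b x → (κ₇ : ℝ) * m ≤ depth c b y →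
        (κ₇ : ℝ) * m ≤ depth c b x' → (κ₇ : ℝ) * m ≤ depth c b (x' + Pi.single (2 : Fin 4) (m : ℤ)) →
          θ * kerCov G r β c b 1 (plane G r (0, 1) x') (plane G r (0, 1) (x' + Pi.single (2 : Fin 4) (m : ℤ))) ≤
            kerCov G r β c b 1 (dens G r x) (dens G r y) ∧
          θ * kerCov G r β c b 1 (dens G r x) (dens G r y) ≤
            kerCov G r β c b 1 (plane G r (0, 1) x') (plane G r (0, 1) (x' + Pi.single (2 : Fin 4) (m : ℤ))))
    -- the instance
    {β : ℝ} (hβ₀ : β₀ ≤ β) (hβ₁ : β₁ ≤ β) (hβ₆ : β₆ ≤ β) (hβ₆' : β₆' ≤ β) (hβ₇ : β₇ ≤ β) (hα : 0 < a β)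
    {cc : Fin 4 → ℤ} {b : ℕ} (hb₁ : (b : ℝ) * a β ≤ ℓ₁) (hb₆ : (b : ℝ) * a β ≤ ℓ₆) (hb₆' : (b : ℝ) * a β ≤ ℓ₆')
    (hb₇ : (b : ℝ) * a β ≤ ℓ₇) (hb₀ : ((b : ℝ) + 3) * a β ≤ ℓ₀)
    {κ : ℕ} (hκ8 : 8 ≤ κ) (hκCg : 4 * Cg ≤ (κ : ℝ) ^ 2) (hκCg' : 4 * Cg' ≤ (κ : ℝ) ^ 2)
    (η : LGConfig 4 G) {x y : Fin 4 → ℤ} {m : ℕ} (hν1 : 1 ≤ ‖siteToE (y - x)‖)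
    (hn₆' : (n₆' : ℝ) ≤ ‖siteToE (y - x)‖) (hn₇ : (n₇ : ℝ) ≤ ‖siteToE (y - x)‖)
    (hm1 : 1 ≤ m) (hn₆m : n₆ ≤ m) (hνm : ‖siteToE (y - x)‖ ≤ m) (hm2 : (m : ℝ) ≤ 2 * ‖siteToE (y - x)‖)
    (h8m : 8 * m ≤ b + 3)
    (hdx : κ * m ≤ depth cc b x) (hdx' : κ * m ≤ depth cc b (x + Pi.single (2 : Fin 4) (m : ℤ)))
    (hdxr : (κ : ℝ) * ‖siteToE (y - x)‖ ≤ depth cc b x) (hdyr : (κ : ℝ) * ‖siteToE (y - x)‖ ≤ depth cc b y)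
    (h7x : (κ₇ : ℝ) * m ≤ depth cc b x) (h7y : (κ₇ : ℝ) * m ≤ depth cc b y)
    (h7x' : (κ₇ : ℝ) * m ≤ depth cc b (x + Pi.single (2 : Fin 4) (m : ℤ)))
    {Kf s₁ : ℝ} (hKf : 0 < Kf) (hs₁ : 0 < s₁) (hs₁ν : s₁ ≤ ‖siteToE (y - x)‖ * a β)
    (hΓm : Kf * ((m : ℝ) * a β) ^ 8 ≤ Γ ((m : ℝ) * a β))
    (hκE : 16 * (1 + Cg + Cg ^ 2) * C₁ ^ 2 ≤ c * Kf * s₁ ^ 8 * ((κ : ℝ) - 2) ^ 8)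
    (hκE' : 32 * (Cg' + Cg' ^ 2) * C₁ ^ 2 ≤ θ * c * Kf * s₁ ^ 8 * ((κ : ℝ) - 2) ^ 8) :
    θ * c * Kf * s₁ ^ 8 / 8 ≤ ‖siteToE (y - x)‖ ^ 8 * kerCov G r β cc b η (dens G r x) (dens G r y) := by
  have hm0 : (0 : ℝ) < m := by exact_mod_cast hm1
  have hκr : (8 : ℝ) ≤ κ := by exact_mod_cast hκ8
  have hκ2 : (6 : ℝ) ≤ (κ : ℝ) - 2 := by linarith only [hκr]
  have hκ0 : (0 : ℝ) < κ := by linarith only [hκr]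
  have hν0 : (0 : ℝ) < ‖siteToE (y - x)‖ := by linarith only [hν1]
  have hk0 : (0 : ℝ) < (κ : ℝ) - 2 := by linarith only [hκ2]
  -- (1) the flat axis value: lower side
  obtain ⟨-, hL⟩ := flatAxis_bounds G r a hc hΓ hbox hC₁ hFBL hGA hβ₀ hβ₁ hβ₆ hα hb₁ hb₆ hb₀ hκ8 hκCg hm1 hn₆m h8m
    hdx hdx'
  -- `s₁ ≤ m a`, hence `B ≤ c K_f a⁸ / 4`
  have hs₁m : s₁ ≤ (m : ℝ) * a β := hs₁ν.trans (mul_le_mul_of_nonneg_right hνm hα.le)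
  have hs8 : s₁ ^ 8 ≤ ((m : ℝ) * a β) ^ 8 := pow_le_pow_left₀ hs₁.le hs₁m 8
  have hcK : 0 ≤ c * Kf := (mul_pos hc hKf).le
  have hB4 : 4 * (1 + Cg + Cg ^ 2) * C₁ ^ 2 / (((κ : ℝ) - 2) * m) ^ 8 ≤ c * Kf * a β ^ 8 / 4 := by
    rw [div_le_iff₀ (by positivity)]
    have h1 : c * Kf * s₁ ^ 8 ≤ c * Kf * ((m : ℝ) * a β) ^ 8 := mul_le_mul_of_nonneg_left hs8 hcK
    have e : c * Kf * a β ^ 8 / 4 * (((κ : ℝ) - 2) * m) ^ 8 = c * Kf * ((m : ℝ) * a β) ^ 8 * ((κ : ℝ) - 2) ^ 8 / 4 := by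
      ring
    rw [e]
    have hk8 : 0 ≤ ((κ : ℝ) - 2) ^ 8 := by positivity
    nlinarith only [hκE, h1, hk8]
  have hpos : 0 < c * Kf * a β ^ 8 := by positivity
  have hax := hL Kf hΓm (by linarith only [hB4, hpos])
  have hax2 : c * Kf * a β ^ 8 / 2 ≤ kerCov G r β cc b 1 (plane G r (0, 1) x)
      (plane G r (0, 1) (x + Pi.single (2 : Fin 4) (m : ℤ))) := by linarith only [hax, hB4]
  -- (2) FlatShape2, lower direction
  obtain ⟨hθ1, -⟩ := hFS β hβ₇ cc b hb₇ x y x m hn₇ hνm hm2 h7x h7y h7x h7x'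
  have hD1 : θ * (c * Kf * a β ^ 8 / 2) ≤ kerCov G r β cc b 1 (dens G r x) (dens G r y) :=
    (mul_le_mul_of_nonneg_left hax2 hθ.le).trans hθ1
  have hD10 : 0 ≤ kerCov G r β cc b 1 (dens G r x) (dens G r y) := le_trans (by positivity) hD1
  -- (3) the budget of GateD from FBL6, and GateD, lower transfer
  obtain ⟨M', hM'⟩ : ∃ M' : ℝ, M' = 2 * C₁ / (((κ : ℝ) - 2) * ‖siteToE (y - x)‖) ^ 4 := ⟨_, rfl⟩
  have hM'0 : 0 ≤ M' := by rw [hM']; positivity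
  have h2d : (2 : ℝ) ≤ ((κ : ℝ) - 2) * ‖siteToE (y - x)‖ := by
    have := mul_le_mul hκ2 hν1 (by norm_num) (by linarith only [hκ2])
    linarith only [this]
  have hbud : ∀ (q : Fin 4 × Fin 4) (z : Fin 4 → ℤ), q.1 < q.2 →
      ((κ : ℝ) - 2) * ‖siteToE (y - x)‖ ≤ depth cc b z →
      |kerE G r β cc b η (plane G r q z) - kerE G r β cc b 1 (plane G r q z)| ≤ M' := by
    intro q z hq hz
    rw [hM']
    exact budget_of_fbl6 G r a hC₁ (hFBL β hβ₁) hb₁ h2d η q z hq hz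
  have hgateD := hGD β hβ₆' κ hκ8 cc b hb₆' η x y hn₆' hdxr hdyr M' hM'0 hbud
  have hDη := gate_transfer_lower hCg'.le hκCg' hκ0 hD10 hgateD
  -- (4) assemble
  have hM'8 : ‖siteToE (y - x)‖ ^ 8 * M' ^ 2 = 4 * C₁ ^ 2 / ((κ : ℝ) - 2) ^ 8 := by
    rw [hM']
    exact pow_mul_budget_sq hν0.ne' hk0.ne'
  have hbud8 : 4 * C₁ ^ 2 / ((κ : ℝ) - 2) ^ 8 * (Cg' + Cg' ^ 2) ≤ θ * c * Kf * s₁ ^ 8 / 8 := by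
    rw [div_mul_eq_mul_div, div_le_iff₀ (by positivity)]
    nlinarith only [hκE']
  have hνa8 : s₁ ^ 8 ≤ (‖siteToE (y - x)‖ * a β) ^ 8 := pow_le_pow_left₀ hs₁.le hs₁ν 8
  have hν8 : 0 ≤ ‖siteToE (y - x)‖ ^ 8 := by positivity
  have hθcK : 0 ≤ θ * c * Kf := by positivity
  calc θ * c * Kf * s₁ ^ 8 / 8
      ≤ θ * c * Kf * (‖siteToE (y - x)‖ * a β) ^ 8 / 4 - 4 * C₁ ^ 2 / ((κ : ℝ) - 2) ^ 8 * (Cg' + Cg' ^ 2) := by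
        nlinarith only [hbud8, hνa8, hθcK]
    _ = ‖siteToE (y - x)‖ ^ 8 * (θ * (c * Kf * a β ^ 8 / 2) / 2) - (Cg' + Cg' ^ 2) * (‖siteToE (y - x)‖ ^ 8 * M' ^ 2) := by
        rw [hM'8]; ring
    _ ≤ ‖siteToE (y - x)‖ ^ 8 * (kerCov G r β cc b 1 (dens G r x) (dens G r y) / 2) -
          (Cg' + Cg' ^ 2) * (‖siteToE (y - x)‖ ^ 8 * M' ^ 2) := by
        gcongr
    _ = ‖siteToE (y - x)‖ ^ 8 * (kerCov G r β cc b 1 (dens G r x) (dens G r y) / 2 - (Cg' + Cg' ^ 2) * M' ^ 2) := by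
        ring
    _ ≤ ‖siteToE (y - x)‖ ^ 8 * kerCov G r β cc b η (dens G r x) (dens G r y) :=
        mul_le_mul_of_nonneg_left hDη hν8


end Pair

end StubInherit

/-! ### Registered sub-goal (closed form) -/

/-- **The FlatShape2 transfer inequality — registered sub-goal `absLeOfTwoSided` of crux stmt-QuantumFields-16207 (line
`inherited-amplitude-gates`, stub `stub_inherit`), closed form of `StubInherit.abs_le_of_two_sided`.**  (The file's main
theorems `StubInherit.pair_upper` / `StubInherit.pair_lower` carry the five data clauses verbatim and exceed the
registry's signature size; this is the step by which `FlatShape2`'s two-sided comparison `θ A ≤ D`, `θ D ≤ A` moves an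
absolute bound from the axis pair to the density pair.)  `|D| ≤ (θ + θ⁻¹)|A|`. [folklore] -/
theorem absLeOfTwoSided : ∀ (θ A D : ℝ), 0 < θ → θ * A ≤ D → θ * D ≤ A → |D| ≤ (θ + θ⁻¹) * |A| :=
  fun _ _ _ hθ h1 h2 => StubInherit.abs_le_of_two_sided hθ h1 h2

end Summit.QuantumFields.YangMills.Cruxes.OSLegsAtWeakCouplingC.InheritedAmplitudeGates

end
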